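import Mathlib

set_option linter.dupNamespace false

/-!
# B3♭ — the one-conic factor law for the WNSH-LF window (letter model), monad-4 g24

Typed *specification / arithmetic* file for the cell `hsemireg-monad-4`, generation g24
(unit `hsemireg-monad-4-g24`, crux item `stmt-HodgeConjecture-18881`, decl `BlochSeedDiscOne`).

**Status sentence.** Nothing in this file is proved toward HC / HC_CM / HC_AV / №4 / 26512 /
18881 / H2.  It records, as kernel-checked algebra, a *class-level* law about letter DESIGNS on
`X = (E_i × E_i)^4`: which alphabets can never carry the Chern character of a WNSH-LF carrier with
Weil charge `μ ≠ 0`, whatever signed multiplicities and monad roles are chosen.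
Designs ≠ displays ≠ monads ≠ sheaves ≠ a SEED.

## The law (pen + machine, memo `B3FLAT-CONICLAW-monad4-g24.md`)

Conventions of monad-4 g22/g23: letters `[a,x,y] = a·A_f + x·X_f + y·Y_f` on a factor
`S_f = E_i × E_i` (`A² = 2pt`, `X² = Y² = −2pt`, pairwise products `0`), `n = a² − x² − y²`,
cells `Z = ⊠_f L(ℓ_f)` with `ch(Z) = ⊗_f (1 + ℓ_f + n_f pt_f)`; a (virtual) design is a finitely
supported `ν : Cell → ℚ`.  The WNSH-LF class is `C(g, μ) = 4·exp(gH) + w(μ) + κ·pt_X`,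
`κ = |μ|²/140`, and its *Lefschetz part* (g23 memo §4 (L); the Weil class `w(μ)` has no
`{1, A, pt}`-component) reads

  (L)  `Σ_Z ν_Z ∏_{f∈I} a_{Z,f} ∏_{f∈J} n_{Z,f} = 4·g^{|I|+2|J|} + [J = univ]·κ`  for all disjoint `I, J ⊆ Fin 4`.

**One-conic factor law** (`conic_law`).  If for some factor `f₀` the function `n` restricted to the
alphabet of `f₀` (every letter occurring in factor `f₀`, all roles and signs pooled) lies in
`span{1, a}` — `n = p + q·a` on that alphabet, "one affine conic" — then (L) forces `κ = 0`, i.e.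
`μ = 0` (`charge_zero_of_kappa_zero`).  Only six instances of (L) are used (`conic_core`):
`(∅,∅), ({f₀},∅), (∅,{f₀})` give `p + q·g = g²`; `(∅,J'), ({f₀},J'), (∅,univ)` with
`J' = univ ∖ {f₀}` give `4g⁶(p + q·g) = 4g⁸ + κ`.  For a LINE-`h` factor the first identity is
`(g − h)² = 0`: a single-LINE design can only carry `4·exp(hH)` (`line_design_twist`).

**LINE designs** (`onLine_n`, `line_design_window_dead`): a pure letter (`x·y = 0`) on the LINE
`a + |x| + |y| = h` has `n = 2h·a − h²`, one conic; hence every single-LINE design — the supports of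
record S′ (LINE 14, designs `ac808a66`, `08162ddb`) and S131 (LINE 16, `bf2edc09`), and 2485 of the
3083 parsable design files of the cell's corpus (`g24/data/coniclaw-corpus.tsv`) — is window-dead for
`μ ≠ 0` at class level.  The BAND-4@{8,10,12} design `1840bf64` and g23's canonical virtual design
(levels {1,2,3}) have `(1,a,n)`-affine rank 3 in every factor and are not touched by this law
(`band4_not_one_conic`); over `ℚ` the law is sharp for (L) (memo §3: rank 3 in every factor ⇒ (L) is
solvable for every `(g, κ)` by tensor-product independence).

Machine ×2: `g24/code/coniclaw.py lines|corpus` (alphabet census, exact) and the g23 engine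
`wnshlat.py check` (full (L) profile) agree on the designs of record.

Typing rules observed: Mathlib only; no proof placeholders, no type-class instances declared, no
custom syntax, no banned options.
-/

namespace Summit.HodgeConjecture.HodgeConjecture.Cruxes.BlochSeedDiscOne.ConicLaw

/-! ## 1. The algebraic core: six Lefschetz moments and one conic force `κ = 0` -/

/-- Core of the one-conic law over any commutative ring: if `n₀ = p + q·a₀` on the support and the
six Lefschetz moments `Σν, Σν a₀, Σν n₀, Σν φ, Σν a₀ φ, Σν n₀ φ` take the WNSH-LF values
`4, 4g, 4g², 4g⁶, 4g⁷, 4g⁸ + κ`, then `κ = 0`. -/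
theorem conic_core {R : Type*} [CommRing R] {ι : Type*} (s : Finset ι)
    (ν a₀ n₀ φ : ι → R) (g κ p q : R)
    (hconic : ∀ i ∈ s, n₀ i = p + q * a₀ i)
    (h1 : ∑ i ∈ s, ν i = 4)
    (h2 : ∑ i ∈ s, ν i * a₀ i = 4 * g)
    (h3 : ∑ i ∈ s, ν i * n₀ i = 4 * g ^ 2)
    (h4 : ∑ i ∈ s, ν i * φ i = 4 * g ^ 6)
    (h5 : ∑ i ∈ s, ν i * a₀ i * φ i = 4 * g ^ 7)
    (h6 : ∑ i ∈ s, ν i * n₀ i * φ i = 4 * g ^ 8 + κ) :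
    κ = 0 := by
  have e3 : ∑ i ∈ s, ν i * n₀ i = p * ∑ i ∈ s, ν i + q * ∑ i ∈ s, ν i * a₀ i := by
    rw [Finset.mul_sum, Finset.mul_sum, ← Finset.sum_add_distrib]
    refine Finset.sum_congr rfl fun i hi => ?_
    rw [hconic i hi]; ring
  have e6 : ∑ i ∈ s, ν i * n₀ i * φ i = p * ∑ i ∈ s, ν i * φ i + q * ∑ i ∈ s, ν i * a₀ i * φ i := by
    rw [Finset.mul_sum, Finset.mul_sum, ← Finset.sum_add_distrib]
    refine Finset.sum_congr rfl fun i hi => ?_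
    rw [hconic i hi]; ring
  rw [h1, h2, h3] at e3
  rw [h4, h5, h6] at e6
  linear_combination e6 - g ^ 6 * e3

/-- The moment form of the conclusion: with a one-conic factor the `n₀`-moments are determined by
the `1`- and `a₀`-moments (this is the whole mechanism). -/
theorem conic_moment_transfer {R : Type*} [CommRing R] {ι : Type*} (s : Finset ι)
    (ν a₀ n₀ φ : ι → R) (p q : R) (hconic : ∀ i ∈ s, n₀ i = p + q * a₀ i) :
    ∑ i ∈ s, ν i * n₀ i * φ i = p * ∑ i ∈ s, ν i * φ i + q * ∑ i ∈ s, ν i * a₀ i * φ i := by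
  rw [Finset.mul_sum, Finset.mul_sum, ← Finset.sum_add_distrib]
  refine Finset.sum_congr rfl fun i hi => ?_
  rw [hconic i hi]; ring

/-- The low-order half of the mechanism: a one-conic factor pins the twist, `g² = p + q·g`
(for a LINE of level `h`, `p = −h²`, `q = 2h`, this is `(g − h)² = 0`). -/
theorem conic_twist {R : Type*} [CommRing R] {ι : Type*} (s : Finset ι)
    (ν a₀ n₀ : ι → R) (g p q : R)
    (hconic : ∀ i ∈ s, n₀ i = p + q * a₀ i)
    (h1 : ∑ i ∈ s, ν i = 4)
    (h2 : ∑ i ∈ s, ν i * a₀ i = 4 * g)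
    (h3 : ∑ i ∈ s, ν i * n₀ i = 4 * g ^ 2)
    (h4inv : Invertible (4 : R)) :
    g ^ 2 = p + q * g := by
  have e3 : ∑ i ∈ s, ν i * n₀ i = p * ∑ i ∈ s, ν i + q * ∑ i ∈ s, ν i * a₀ i := by
    rw [Finset.mul_sum, Finset.mul_sum, ← Finset.sum_add_distrib]
    refine Finset.sum_congr rfl fun i hi => ?_
    rw [hconic i hi]; ring
  rw [h1, h2, h3] at e3
  have h4 : (4 : R) * (g ^ 2 - (p + q * g)) = 0 := by linear_combination e3
  have : g ^ 2 - (p + q * g) = 0 := by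
    have := congrArg (fun t => ⅟(4 : R) * t) h4
    simpa [← mul_assoc] using this
  exact sub_eq_zero.mp this

/-! ## 2. Letters, cells, the Lefschetz window (L) and the design-level law -/

/-- A letter `[a,x,y] = a·A + x·X + y·Y` on one factor `S = E_i × E_i`. -/
structure Letter where
  a : ℤ
  x : ℤ
  y : ℤ
deriving DecidableEq, Repr

/-- `n(ℓ) = ℓ²/2` in units of the point class: `a² − x² − y²`. -/
def Letter.n (l : Letter) : ℤ := l.a ^ 2 - l.x ^ 2 - l.y ^ 2

/-- A cell of `X = S⁴`: one letter per factor (`Z = ⊠_f L(ℓ_f)`). -/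
abbrev Cell := Fin 4 → Letter

/-- Lefschetz moment of a virtual design `ν` supported on `s`:
`Σ_Z ν_Z ∏_{f∈I} a_{Z,f} ∏_{f∈J} n_{Z,f}` = the coefficient of `4 e^{gH} + κ pt` it must match. -/
def lefMoment (s : Finset Cell) (ν : Cell → ℚ) (I J : Finset (Fin 4)) : ℚ :=
  ∑ Z ∈ s, ν Z * (∏ f ∈ I, ((Z f).a : ℚ)) * (∏ f ∈ J, ((Z f).n : ℚ))

/-- (L): the Lefschetz part of the WNSH-LF window for the class `4e^{gH} + w(μ) + κ·pt_X`
(`κ = |μ|²/140`); g23 memo §4. -/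
def LefschetzWindow (s : Finset Cell) (ν : Cell → ℚ) (g κ : ℚ) : Prop :=
  ∀ I J : Finset (Fin 4), Disjoint I J →
    lefMoment s ν I J = 4 * g ^ (I.card + 2 * J.card) + (if J = Finset.univ then κ else 0)

/-- One affine conic in factor `f`: `n = p + q·a` for every letter occurring in factor `f`. -/
def OneConicAt (s : Finset Cell) (f : Fin 4) : Prop :=
  ∃ p q : ℚ, ∀ Z ∈ s, ((Z f).n : ℚ) = p + q * (Z f).a

private lemma singleton_ne_univ (f : Fin 4) : ({f} : Finset (Fin 4)) ≠ Finset.univ := by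
  intro h
  have := congrArg Finset.card h
  simp at this

private lemma empty_ne_univ : (∅ : Finset (Fin 4)) ≠ Finset.univ := by
  intro h
  have := congrArg Finset.card h
  simp at this

private lemma erase_ne_univ (f : Fin 4) : Finset.univ.erase f ≠ (Finset.univ : Finset (Fin 4)) := by
  intro h
  have hf : f ∈ Finset.univ.erase f := by rw [h]; exact Finset.mem_univ f
  simp at hf

private lemma card_erase (f : Fin 4) : (Finset.univ.erase f).card = 3 := by
  rw [Finset.card_erase_of_mem (Finset.mem_univ f)]; simp

/-- **One-conic factor law.**  A (virtual, rational) design whose alphabet in some factor lies on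
one affine conic `n = p + q·a` satisfies the Lefschetz window (L) only with `κ = |μ|²/140 = 0`. -/
theorem conic_law (s : Finset Cell) (ν : Cell → ℚ) (g κ : ℚ) (f : Fin 4)
    (hc : OneConicAt s f) (hL : LefschetzWindow s ν g κ) : κ = 0 := by
  obtain ⟨p, q, hpq⟩ := hc
  set J' : Finset (Fin 4) := Finset.univ.erase f with hJ'
  have hfJ' : f ∉ J' := by simp [hJ']
  have hdisj : Disjoint ({f} : Finset (Fin 4)) J' := by simpa using hfJ'
  -- the six instances of (L)
  have h1 := hL ∅ ∅ (disjoint_bot_left)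
  have h2 := hL {f} ∅ (disjoint_bot_right)
  have h3 := hL ∅ {f} (disjoint_bot_left)
  have h4 := hL ∅ J' (disjoint_bot_left)
  have h5 := hL {f} J' hdisj
  have h6 := hL ∅ Finset.univ (disjoint_bot_left)
  simp only [lefMoment, Finset.prod_empty, Finset.prod_singleton, mul_one, Finset.card_empty,
    Finset.card_singleton, if_neg (singleton_ne_univ f), if_neg empty_ne_univ,
    if_neg (erase_ne_univ f), hJ', card_erase, add_zero] at h1 h2 h3 h4 h5 h6
  -- split the full `n`-product at the factor `f`
  have hsplit : ∀ Z : Cell, (∏ f' ∈ (Finset.univ : Finset (Fin 4)), ((Z f').n : ℚ))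
      = ((Z f).n : ℚ) * ∏ f' ∈ Finset.univ.erase f, ((Z f').n : ℚ) := by
    intro Z
    exact (Finset.mul_prod_erase Finset.univ (fun f' => ((Z f').n : ℚ)) (Finset.mem_univ f)).symm
  simp only [hsplit] at h6
  refine conic_core s ν (fun Z => ((Z f).a : ℚ)) (fun Z => ((Z f).n : ℚ))
    (fun Z => ∏ f' ∈ Finset.univ.erase f, ((Z f').n : ℚ)) g κ p q hpq ?_ ?_ ?_ ?_ ?_ ?_
  · simpa using h1
  · simpa using h2
  · simpa using h3
  · simpa using h4
  · simpa [mul_assoc] using h5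
  · simpa [mul_assoc] using h6

/-- `κ = |μ|²/140 = 0` means `μ = p + q i = 0`. -/
theorem charge_zero_of_kappa_zero (κ p q : ℚ) (hk : 140 * κ = p ^ 2 + q ^ 2) (h0 : κ = 0) :
    p = 0 ∧ q = 0 := by
  subst h0
  have hp : p ^ 2 = 0 := by nlinarith [sq_nonneg p, sq_nonneg q]
  have hq : q ^ 2 = 0 := by nlinarith [sq_nonneg p, sq_nonneg q]
  exact ⟨pow_eq_zero_iff two_ne_zero |>.mp hp, pow_eq_zero_iff two_ne_zero |>.mp hq⟩

/-! ## 3. LINE alphabets are one-conic -/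

/-- A pure letter on the LINE of level `h`: `x·y = 0` and `a + β = h`, `β = |x| + |y|`. -/
def OnLine (h : ℤ) (l : Letter) : Prop := l.x * l.y = 0 ∧ l.a + |l.x| + |l.y| = h

/-- On the LINE of level `h`: `n = a² − β² = (a − β)(a + β) = 2h·a − h²` — one affine conic. -/
theorem onLine_n (h : ℤ) (l : Letter) (hl : OnLine h l) : l.n = 2 * h * l.a - h ^ 2 := by
  obtain ⟨hxy, hsum⟩ := hl
  unfold Letter.n
  rcases mul_eq_zero.mp hxy with hx | hy
  · rw [hx, abs_zero, add_zero] at hsum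
    rw [hx]
    have ha : l.a = h - |l.y| := by linarith
    rw [ha]
    linear_combination (sq_abs l.y)
  · rw [hy, abs_zero, add_zero] at hsum
    rw [hy]
    have ha : l.a = h - |l.x| := by linarith
    rw [ha]
    linear_combination (sq_abs l.x)

/-- A design all of whose factor-`f` letters lie on one LINE is one-conic in factor `f`
(`p = −h²`, `q = 2h`). -/
theorem oneConic_of_line (s : Finset Cell) (f : Fin 4) (h : ℤ)
    (hline : ∀ Z ∈ s, OnLine h (Z f)) : OneConicAt s f := by
  refine ⟨-((h : ℚ) ^ 2), 2 * (h : ℚ), fun Z hZ => ?_⟩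
  have := onLine_n h (Z f) (hline Z hZ)
  rw [this]; push_cast; ring

/-- **Single-LINE designs are window-dead for `μ ≠ 0`.**  If in some factor every letter of the
design lies on one LINE `a + |x| + |y| = h` (pure letters), the Lefschetz window forces `κ = 0`;
with `140 κ = |μ|²` this is `μ = 0`.  Applies to the supports of record S′ (LINE 14) and S131
(LINE 16) with ANY multiplicities and roles. -/
theorem line_design_window_dead (s : Finset Cell) (ν : Cell → ℚ) (g κ : ℚ) (f : Fin 4) (h : ℤ)
    (hline : ∀ Z ∈ s, OnLine h (Z f)) (hL : LefschetzWindow s ν g κ)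
    (p q : ℚ) (hk : 140 * κ = p ^ 2 + q ^ 2) : p = 0 ∧ q = 0 :=
  charge_zero_of_kappa_zero κ p q hk (conic_law s ν g κ f (oneConic_of_line s f h hline) hL)

/-- **Single-LINE designs pin the twist: `g = h`.**  On a LINE-`h` factor the three lowest
Lefschetz moments already force `(g − h)² = 0`; so the only window class a LINE-`h` design can carry
is `4·exp(hH)` (`μ = 0`, `g = h`), the class of `4` copies of the hub cell. -/
theorem line_design_twist (s : Finset Cell) (ν : Cell → ℚ) (g κ : ℚ) (f : Fin 4) (h : ℤ)
    (hline : ∀ Z ∈ s, OnLine h (Z f)) (hL : LefschetzWindow s ν g κ) : g = h := by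
  have h1 := hL ∅ ∅ (disjoint_bot_left)
  have h2 := hL {f} ∅ (disjoint_bot_right)
  have h3 := hL ∅ {f} (disjoint_bot_left)
  simp only [lefMoment, Finset.prod_empty, Finset.prod_singleton, mul_one, Finset.card_empty,
    Finset.card_singleton, if_neg (singleton_ne_univ f), if_neg empty_ne_univ, add_zero] at h1 h2 h3
  have hc : ∀ Z ∈ s, ((Z f).n : ℚ) = -((h : ℚ) ^ 2) + 2 * (h : ℚ) * (Z f).a := by
    intro Z hZ
    have := onLine_n h (Z f) (hline Z hZ)
    rw [this]; push_cast; ring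
  have key := conic_twist s ν (fun Z => ((Z f).a : ℚ)) (fun Z => ((Z f).n : ℚ)) g
    (-((h : ℚ) ^ 2)) (2 * (h : ℚ)) hc (by simpa using h1) (by simpa using h2) (by simpa using h3)
    (invertibleOfNonzero (by norm_num))
  have hsq : (g - h) ^ 2 = 0 := by linear_combination key
  exact sub_eq_zero.mp (pow_eq_zero_iff two_ne_zero |>.mp hsq)

/-! ## 4. Instances of record -/

/-- Letters of the support S′ (LINE 14, designs `ac808a66` / `08162ddb`): the hub `14·I`, a charged
letter `[12,−2,0]` and the A-letter `7ℓ_ζ = [7,0,7]` all lie on LINE 14. -/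
example : OnLine 14 ⟨14, 0, 0⟩ ∧ OnLine 14 ⟨12, -2, 0⟩ ∧ OnLine 14 ⟨7, 0, 7⟩ := by
  unfold OnLine; decide

/-- … and on the conic `n = 28a − 196` reported by `coniclaw.py lines` for `ac808a66`. -/
example : Letter.n ⟨14, 0, 0⟩ = 28 * 14 - 196 ∧ Letter.n ⟨12, -2, 0⟩ = 28 * 12 - 196
    ∧ Letter.n ⟨7, 0, 7⟩ = 28 * 7 - 196 := by
  unfold Letter.n; decide

/-- Letters of S131 (LINE 16, design `bf2edc09`): conic `n = 32a − 256`. -/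
example : OnLine 16 ⟨16, 0, 0⟩ ∧ OnLine 16 ⟨13, 0, -3⟩ ∧ Letter.n ⟨13, 0, -3⟩ = 32 * 13 - 256 := by
  unfold OnLine Letter.n; decide

/-- The BAND-4@{8,10,12} alphabet (design `1840bf64`) is NOT one-conic: the hub letters
`8I, 10I, 12I` alone have non-collinear `(a, n) = (8,64), (10,100), (12,144)`.  The law is silent
there (that design fails the window for a different reason: g23's digit law `56 ∤ μ`). -/
theorem band4_not_one_conic :
    ¬ ∃ p q : ℚ, (64 : ℚ) = p + q * 8 ∧ (100 : ℚ) = p + q * 10 ∧ (144 : ℚ) = p + q * 12 := by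
  rintro ⟨p, q, h1, h2, h3⟩
  linarith

/-- Two LINE levels already break collinearity: the hub of level `h' ≠ h` is off the conic of
LINE `h` (since `h'² − (2h h' − h²) = (h' − h)² ≠ 0`). -/
theorem hub_off_line_conic (h h' : ℤ) (hne : h' ≠ h) : Letter.n ⟨h', 0, 0⟩ ≠ 2 * h * h' - h ^ 2 := by
  unfold Letter.n
  intro heq
  have : (h' - h) ^ 2 = 0 := by linear_combination heq
  exact hne (sub_eq_zero.mp (pow_eq_zero_iff two_ne_zero |>.mp this))

end Summit.HodgeConjecture.HodgeConjecture.Cruxes.BlochSeedDiscOne.ConicLaw
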